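import Mathlib.LinearAlgebra.Matrix.PosDef
import Mathlib.Algebra.QuadraticDiscriminant
import Mathlib.Tactic

/-!
# Route `AnisotropyChord` / H0 rotor rung — PART N23: the Gram (Cauchy–Schwarz) lower bound for a resolvent quadratic form

Theory seat `hubbard-h0-rotor-theory-1`, cycle 19 (memo ROTOR-THEORY-19 §237 LEMMA CS, PORT SPEC M74 `gram_lower_bound`).  Mathlib-only, real
symmetric matrices; PROVED here (no `sorry`):

* `gram_cauchySchwarz` : for a symmetric positive-semidefinite `M` and vectors `b, x`:
  `(b ⬝ᵥ M *ᵥ x)^2 ≤ (b ⬝ᵥ M *ᵥ b) * (x ⬝ᵥ M *ᵥ x)` (Cauchy–Schwarz in the `M`-inner product, via the discriminant).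
* `gram_lower_bound` : if `M *ᵥ x = v` (so `v ⬝ᵥ x = ⟨v, M⁻¹ v⟩` when `M` is invertible) and `0 < b ⬝ᵥ M *ᵥ b`, then
  `(b ⬝ᵥ v)^2 / (b ⬝ᵥ M *ᵥ b) ≤ v ⬝ᵥ x` — the one-vector Gram bound; the k-vector Gram bound of LEMMA CS″ is this
  statement for `b` ranging over the span of the trial vectors.

In the memo `M = M̃(T)` is the pole-removed Krein matrix on the hard-core set, `v` the free symmetric mode, and the bound is the
certificate `Φ₁(T) ≥ CS(T)`; only the abstract inequality is typed here.

PORT (prover seat `hubbard-h0-rotor-p1` g20): theory seat file `cycle19/lean/PartN23.lean` (sha16 f2b83182e1dd9af3) verbatim,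
except the import line (narrowed from `import Mathlib`) and `set_option linter.dupNamespace false`.  Helper file for the S-bridge
dossier of stmt-HubbardSuperconductivity-19089; it closes no item.  No definition is introduced.  (The complex positive-definite
form of the Gram bound is `…Transfer.gram_lower_bound` in `AnisotropyChordTransferKreinLemmas`.)
-/

set_option linter.dupNamespace false

namespace Summit.HubbardSuperconductivity.HubbardSuperconductivity.Theorems.AnisotropyChord.Transfer.Krein

open Matrix

variable {n : Type*} [Fintype n]

/-- Symmetry of the bilinear form of a symmetric real matrix. -/
theorem dotProduct_mulVec_symm {M : Matrix n n ℝ} (hsym : Mᵀ = M) (x y : n → ℝ) :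
    x ⬝ᵥ M *ᵥ y = y ⬝ᵥ M *ᵥ x := by
  rw [dotProduct_mulVec, ← vecMul_transpose, hsym, dotProduct_comm]

/-- Expansion of the quadratic form at `b - t • x`. -/
theorem quadForm_sub_smul {M : Matrix n n ℝ} (hsym : Mᵀ = M) (b x : n → ℝ) (t : ℝ) :
    (b - t • x) ⬝ᵥ M *ᵥ (b - t • x)
      = (x ⬝ᵥ M *ᵥ x) * t * t + (-(2 * (b ⬝ᵥ M *ᵥ x))) * t + b ⬝ᵥ M *ᵥ b := by
  have hxb : x ⬝ᵥ M *ᵥ b = b ⬝ᵥ M *ᵥ x := dotProduct_mulVec_symm hsym x b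
  simp only [mulVec_sub, mulVec_smul, sub_dotProduct, dotProduct_sub, smul_dotProduct, dotProduct_smul,
    smul_eq_mul, hxb]
  ring

/-- Cauchy–Schwarz in the (possibly degenerate) inner product of a symmetric positive-semidefinite real matrix. -/
theorem gram_cauchySchwarz {M : Matrix n n ℝ} (hsym : Mᵀ = M) (hpsd : ∀ y : n → ℝ, 0 ≤ y ⬝ᵥ M *ᵥ y)
    (b x : n → ℝ) :
    (b ⬝ᵥ M *ᵥ x) ^ 2 ≤ (b ⬝ᵥ M *ᵥ b) * (x ⬝ᵥ M *ᵥ x) := by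
  have hquad : ∀ t : ℝ, 0 ≤ (x ⬝ᵥ M *ᵥ x) * (t * t) + (-(2 * (b ⬝ᵥ M *ᵥ x))) * t + b ⬝ᵥ M *ᵥ b := by
    intro t
    have h := hpsd (b - t • x)
    rw [quadForm_sub_smul hsym b x t] at h
    linarith [h]
  have hd := discrim_le_zero hquad
  rw [discrim] at hd
  nlinarith [hd]

/-- LEMMA CS (one-vector Gram bound): `⟨v, M⁻¹ v⟩ ≥ ⟨b, v⟩² / ⟨b, M b⟩`, stated through a solution `x` of `M x = v`. -/
theorem gram_lower_bound {M : Matrix n n ℝ} (hsym : Mᵀ = M) (hpsd : ∀ y : n → ℝ, 0 ≤ y ⬝ᵥ M *ᵥ y)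
    {v x b : n → ℝ} (hx : M *ᵥ x = v) (hb : 0 < b ⬝ᵥ M *ᵥ b) :
    (b ⬝ᵥ v) ^ 2 / (b ⬝ᵥ M *ᵥ b) ≤ v ⬝ᵥ x := by
  have hcs := gram_cauchySchwarz hsym hpsd b x
  have h1 : b ⬝ᵥ M *ᵥ x = b ⬝ᵥ v := by rw [hx]
  have h2 : x ⬝ᵥ M *ᵥ x = v ⬝ᵥ x := by rw [hx, dotProduct_comm]
  rw [h1, h2] at hcs
  rw [div_le_iff₀ hb]
  have hc := mul_comm (b ⬝ᵥ M *ᵥ b) (v ⬝ᵥ x)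
  linarith [hcs, hc]

/-- The same with a positive-DEFINITE hypothesis packaged as Mathlib's `Matrix.PosDef` (real case). -/
theorem gram_lower_bound_of_posDef {M : Matrix n n ℝ} (hM : M.PosDef)
    {v x b : n → ℝ} (hx : M *ᵥ x = v) (hb : b ≠ 0) :
    (b ⬝ᵥ v) ^ 2 / (b ⬝ᵥ M *ᵥ b) ≤ v ⬝ᵥ x := by
  have hsym : Mᵀ = M := by
    have h := hM.1.eq
    rwa [Matrix.conjTranspose_eq_transpose_of_trivial] at h
  have hpsd : ∀ y : n → ℝ, 0 ≤ y ⬝ᵥ M *ᵥ y := by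
    intro y
    have h := (Matrix.posSemidef_iff_dotProduct_mulVec.mp hM.posSemidef).2 y
    simpa using h
  have hbpos : 0 < b ⬝ᵥ M *ᵥ b := by
    have h := (Matrix.posDef_iff_dotProduct_mulVec.mp hM).2 hb
    simpa using h
  exact gram_lower_bound hsym hpsd hx hbpos

end Summit.HubbardSuperconductivity.HubbardSuperconductivity.Theorems.AnisotropyChord.Transfer.Krein
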